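import Mathlib
import Summits.Ventures.PercRepro2.Defs
import Summits.Ventures.PercRepro2.HCov
import Summits.Ventures.PercRepro2.PendantRoot
import Summits.Ventures.PercRepro2.PendantEdm

/-!
# The a₃-leaf step of the a₃-first induction is one quadratic inequality (blind cell PercRepro2,
mine-2 g16; proofs/MINE2-A3FIRST.md §7)

Let `a₃` be a LEAF: its only edge is `f = {a₃, y}`. Along the weight `t = p f` of that edge the
covariance form `Gc` is a QUADRATIC polynomial, not a cubic — the copy-1 masses of the kernel
(`P(Q)`, `gap`, `E_Q[σ_b σ_o]`, `E_Q[σ_o]`) are `a₃`-free and do not see `f` (`PendantRoot.Free`),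
while every other mass is affine in `t` (`prob_eq_pin`), and every product in `Gc` has at most two
non-free factors. Hence (**`Gc_leaf_eq`**)

  `Gc(p[f ↦ t]) = (1 − t) · Gc(p[f ↦ 0]) + t · Gc(p[f ↦ 1]) − t (1 − t) · c₂`,

with the quadratic coefficient `c₂ = 2 [Gc(p[f ↦ 0]) + Gc(p[f ↦ 1]) − 2 Gc(p[f ↦ ½])]` (`c2`), and
(**`leaf_step`**) the weighted contraction monotonicity `p f · Gc(p[f ↦ 1]) ≤ Gc(p)` at the leaf
follows from (HCOV) at the deleted graph (`0 ≤ Gc(p[f ↦ 0])`, the induction hypothesis) and the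
ONE inequality `c₂ ≤ Gc(p[f ↦ 0])` — «the activation interaction of copies 2 and 3 is at most the
inactive value» — for every weight `0 ≤ p f ≤ 1`. With `Gc(p[f ↦ 1]) = Gc(G/f)` (the `a₃`-variant
of `GcTransport.Gc_update_one_eq_contract`) this is `A3RECM.A3RECMAt` at a leaf edge.
-/

namespace Summit.Ventures.PercRepro2

open UnionCluster CovForm PendantRoot

namespace A3Leaf

variable {V : Type*} {E : Type*} [Fintype E] [DecidableEq E] [Fintype V] [DecidableEq V]
  {R : Type*} [Field R] [LinearOrder R] [IsStrictOrderedRing R]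

section Mix

variable (p : E → R) (f : E)

omit [Fintype V] [DecidableEq V] [LinearOrder R] [IsStrictOrderedRing R] in
/-- A probability at `p[f ↦ t]` is the mixture `(1 − t) · P_{p[f↦0]} + t · P_{p[f↦1]}`. -/
lemma prob_update_mix (A : Set (Config E)) (t : R) :
    prob (Function.update p f t) A =
      (1 - t) * prob (Function.update p f 0) A + t * prob (Function.update p f 1) A := by
  rw [prob_eq_pin (Function.update p f t) A f, Function.update_idem, Function.update_idem,
    Function.update_self]
  ring

omit [Fintype V] [DecidableEq V] [LinearOrder R] [IsStrictOrderedRing R] in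
/-- A free event has the same probability at `p[f ↦ 1]` and at `p[f ↦ 0]`. -/
lemma prob_update_one_eq_zero_of_free {A : Set (Config E)} (hA : Free f A) :
    prob (Function.update p f 1) A = prob (Function.update p f 0) A := by
  rw [PendantEdm.prob_update_of_free p hA 1, PendantEdm.prob_update_of_free p hA 0]

end Mix

section Quadratic

variable (p : E → R) (ends : E → Sym2 V) (f : E) (o a₁ a₂ a₃ b : V)

/-- The quadratic coefficient of `t ↦ Gc(p[f ↦ t])`: `2 [Gc(0) + Gc(1) − 2 Gc(½)]`. -/
noncomputable def c2 : R :=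
  2 * (Gc (Function.update p f 0) ends o a₁ a₂ a₃ b + Gc (Function.update p f 1) ends o a₁ a₂ a₃ b -
    2 * Gc (Function.update p f (1 / 2)) ends o a₁ a₂ a₃ b)

variable {ends f o a₁ a₂ a₃ b} {y : V}

omit [Fintype V] [DecidableEq V] in
/-- **`Gc` is quadratic along the weight of the leaf edge `f = {a₃, y}`.** -/
theorem Gc_leaf_eq (hf : ends f = s(a₃, y)) (hleaf : ∀ e, a₃ ∈ ends e → e = f) (h3y : a₃ ≠ y)
    (h31 : a₃ ≠ a₁) (h32 : a₃ ≠ a₂) (h3o : a₃ ≠ o) (h3b : a₃ ≠ b) (t : R) :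
    Gc (Function.update p f t) ends o a₁ a₂ a₃ b =
      (1 - t) * Gc (Function.update p f 0) ends o a₁ a₂ a₃ b +
        t * Gc (Function.update p f 1) ends o a₁ a₂ a₃ b -
        t * (1 - t) * c2 p ends f o a₁ a₂ a₃ b := by
  -- the free events: everything mentioning only `o, a₁, a₂, b`
  have fc : ∀ {x z : V}, x ≠ a₃ → z ≠ a₃ → Free f (connEvent ends x z) :=
    fun hx hz => free_connEvent hf hleaf h3y hx hz
  have fQ : Free f (avoidAll ends a₂ {a₁}) := by
    rw [avoidAll_eq_compl]
    exact (fc (Ne.symm h31) (Ne.symm h32)).compl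
  -- constant blocks
  have hPQ : ∀ s : R, prob (Function.update p f s) (avoidAll ends a₂ {a₁}) =
      prob p (avoidAll ends a₂ {a₁}) := fun s => PendantEdm.prob_update_of_free p fQ s
  have hEQbo : ∀ s : R, EQbo (Function.update p f s) ends o a₁ a₂ b = EQbo p ends o a₁ a₂ b := by
    intro s
    simp only [EQbo]
    rw [PendantEdm.prob_update_of_free p
        (fQ.inter ((fc (Ne.symm h31) (Ne.symm h3o)).inter (fc (Ne.symm h31) (Ne.symm h3b)))) s,
      PendantEdm.prob_update_of_free p
        (fQ.inter ((fc (Ne.symm h32) (Ne.symm h3o)).inter (fc (Ne.symm h32) (Ne.symm h3b)))) s,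
      PendantEdm.prob_update_of_free p
        (fQ.inter ((fc (Ne.symm h32) (Ne.symm h3o)).inter (fc (Ne.symm h31) (Ne.symm h3b)))) s,
      PendantEdm.prob_update_of_free p
        (fQ.inter ((fc (Ne.symm h31) (Ne.symm h3o)).inter (fc (Ne.symm h32) (Ne.symm h3b)))) s]
  have hEQo : ∀ s : R, EQo (Function.update p f s) ends o a₁ a₂ = EQo p ends o a₁ a₂ := by
    intro s
    simp only [EQo]
    rw [PendantEdm.prob_update_of_free p (fQ.inter (fc (Ne.symm h31) (Ne.symm h3o))) s,
      PendantEdm.prob_update_of_free p (fQ.inter (fc (Ne.symm h32) (Ne.symm h3o))) s]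
  have hgap : ∀ s : R, gap (Function.update p f s) ends a₁ a₂ b = gap p ends a₁ a₂ b := by
    intro s
    simp only [gap]
    rw [PendantEdm.prob_update_of_free p (fc (Ne.symm h32) (Ne.symm h3b)) s,
      PendantEdm.prob_update_of_free p (fc (Ne.symm h31) (Ne.symm h3b)) s]
  -- affine blocks (at the two weights `t` and `½` that appear)
  have hD : ∀ s : R, prob (Function.update p f s) (PDEvent ends a₁ a₂ a₃) =
      (1 - s) * prob (Function.update p f 0) (PDEvent ends a₁ a₂ a₃) +
        s * prob (Function.update p f 1) (PDEvent ends a₁ a₂ a₃) :=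
    fun s => prob_update_mix p f _ s
  have hDo : ∀ s : R, Do (Function.update p f s) ends o a₁ a₂ a₃ =
      (1 - s) * Do (Function.update p f 0) ends o a₁ a₂ a₃ +
        s * Do (Function.update p f 1) ends o a₁ a₂ a₃ := by
    intro s; have hm := fun A => prob_update_mix p f A s; simp only [Do, hm]; ring
  have hEQb3 : ∀ s : R, EQb3 (Function.update p f s) ends a₁ a₂ a₃ b =
      (1 - s) * EQb3 (Function.update p f 0) ends a₁ a₂ a₃ b +
        s * EQb3 (Function.update p f 1) ends a₁ a₂ a₃ b := by
    intro s; have hm := fun A => prob_update_mix p f A s; simp only [EQb3, hm]; ring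
  have hEQb3o : ∀ s : R, EQb3o (Function.update p f s) ends o a₁ a₂ a₃ b =
      (1 - s) * EQb3o (Function.update p f 0) ends o a₁ a₂ a₃ b +
        s * EQb3o (Function.update p f 1) ends o a₁ a₂ a₃ b := by
    intro s; have hm := fun A => prob_update_mix p f A s; simp only [EQb3o, hm]; ring
  have hEQ3 : ∀ s : R, EQ3 (Function.update p f s) ends a₁ a₂ a₃ =
      (1 - s) * EQ3 (Function.update p f 0) ends a₁ a₂ a₃ +
        s * EQ3 (Function.update p f 1) ends a₁ a₂ a₃ := by
    intro s; have hm := fun A => prob_update_mix p f A s; simp only [EQ3, hm]; ring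
  have hEQ3o : ∀ s : R, EQ3o (Function.update p f s) ends o a₁ a₂ a₃ =
      (1 - s) * EQ3o (Function.update p f 0) ends o a₁ a₂ a₃ +
        s * EQ3o (Function.update p f 1) ends o a₁ a₂ a₃ := by
    intro s; have hm := fun A => prob_update_mix p f A s; simp only [EQ3o, hm]; ring
  have hPDb : ∀ s : R, PDb (Function.update p f s) ends a₁ a₂ a₃ b =
      (1 - s) * PDb (Function.update p f 0) ends a₁ a₂ a₃ b +
        s * PDb (Function.update p f 1) ends a₁ a₂ a₃ b := by
    intro s; have hm := fun A => prob_update_mix p f A s; simp only [PDb, hm]; ring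
  have hPDbo : ∀ s : R, PDbo (Function.update p f s) ends o a₁ a₂ a₃ b =
      (1 - s) * PDbo (Function.update p f 0) ends o a₁ a₂ a₃ b +
        s * PDbo (Function.update p f 1) ends o a₁ a₂ a₃ b := by
    intro s; have hm := fun A => prob_update_mix p f A s; simp only [PDbo, hm]; ring
  -- assemble
  simp only [c2, Gc, DEF]
  simp only [hPQ, hEQbo, hEQo, hgap]
  rw [hD t, hDo t, hEQb3 t, hEQb3o t, hEQ3 t, hEQ3o t, hPDb t, hPDbo t,
    hD (1 / 2), hDo (1 / 2), hEQb3 (1 / 2), hEQb3o (1 / 2), hEQ3 (1 / 2), hEQ3o (1 / 2),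
    hPDb (1 / 2), hPDbo (1 / 2)]
  ring

omit [Fintype V] [DecidableEq V] in
/-- **The leaf step.** At a leaf edge `f = {a₃, y}` with `0 ≤ p f ≤ 1`, the weighted contraction
monotonicity `p f · Gc(p[f ↦ 1]) ≤ Gc(p)` follows from `0 ≤ Gc(p[f ↦ 0])` (HCOV at the deleted
graph) and `c₂ ≤ Gc(p[f ↦ 0])`. -/
theorem leaf_step (hf : ends f = s(a₃, y)) (hleaf : ∀ e, a₃ ∈ ends e → e = f) (h3y : a₃ ≠ y)
    (h31 : a₃ ≠ a₁) (h32 : a₃ ≠ a₂) (h3o : a₃ ≠ o) (h3b : a₃ ≠ b)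
    (ht0 : 0 ≤ p f) (ht1 : p f ≤ 1)
    (h0 : 0 ≤ Gc (Function.update p f 0) ends o a₁ a₂ a₃ b)
    (hc : c2 p ends f o a₁ a₂ a₃ b ≤ Gc (Function.update p f 0) ends o a₁ a₂ a₃ b) :
    p f * Gc (Function.update p f 1) ends o a₁ a₂ a₃ b ≤ Gc p ends o a₁ a₂ a₃ b := by
  have key := Gc_leaf_eq (p := p) hf hleaf h3y h31 h32 h3o h3b (p f)
  rw [Function.update_eq_self] at key
  rw [key]
  set G0 := Gc (Function.update p f 0) ends o a₁ a₂ a₃ b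
  set G1 := Gc (Function.update p f 1) ends o a₁ a₂ a₃ b
  set c := c2 p ends f o a₁ a₂ a₃ b
  set t := p f
  have h1t : 0 ≤ 1 - t := by linarith
  nlinarith [mul_nonneg h1t (mul_nonneg ht0 (sub_nonneg.mpr hc)), mul_nonneg h1t (mul_nonneg h1t h0)]

end Quadratic

end A3Leaf

end Summit.Ventures.PercRepro2
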